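import Literature.Computability.QuantumComplexity.GaussianCellsAngles
import HarnessLib

/-!
# The mass table of the Grover–Rudolph cosine machine: signed Gaussian integrals at integer points

Topic `Literature/Computability/QuantumComplexity`; the TABLE fed to `GaussianCellsAngles.lean`
(`MassTable`, `Accurate`, `machineA`, `aOf`). The closed-form prefix mass at level `j` is
`prefG = G(c, hi) − G(c, lo)` with INTEGER endpoints `lo = h·2^{ℓ−j} − 2^{ℓ−1}`, `hi = lo + 2^{ℓ−j}`
(`GaussianCells.prefG`, `G = GaussIntegral.gaussF`), and `G(π/S, u)` is approximated to `2^{−p}` by the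
rational `gaussFApprox S u p U` of `GaussIntegralFP.lean` (`4u² ≤ U·S`). Extending by oddness to negative
points gives the machine's table:

* `sG S p U x` (`x : ℤ`; `= ±gaussFApprox S |x| p U`), `abs_gaussF_sub_sG_le`;
* `loZ`, `hiZ` (the endpoints as integers; `cast_loZ`, `cast_hiZ` match `prefG`), `tableT S p U ℓ j h`;
* **`accurate_tableT`**: `Accurate (π/S) (tableT S p U ℓ) (2/2^p)` for `1 ≤ S` and `4·4^ℓ ≤ U·S`.

Everything here is proved; definitions have bodies; no named fact is introduced.

## References

* O. Regev, J. ACM 56 (2009), art. 34, Lemma 3.12 (proof), §2 p. 11 (finite precision) [Regev2009].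
* M. Abramowitz, I. A. Stegun, *Handbook of Mathematical Functions*, NBS 1964, 7.1.5 [AbramowitzStegun1964].
-/

noncomputable section

namespace Literature.Computability.QuantumComplexity

open Real Finset GaussianCells Literature.Computability.Complexity.GaussIntegral

namespace GRMassTable

variable (S : ℚ) (p U : ℕ)

/-- **The signed approximation** of `G(π/S, x)` at an integer point. [cite: Regev2009, §2 p. 11] -/
def sG (x : ℤ) : ℚ := if 0 ≤ x then gaussFApprox S x.toNat p U else -gaussFApprox S (-x).toNat p U

variable {S p U}

/-- **Accuracy of the signed approximation**: `|G(π/S, x) − sG x| ≤ 2^{−p}` for `1 ≤ S`, `4x² ≤ U·S`.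
[cite: Regev2009, §2 p. 11] [cite: AbramowitzStegun1964, 7.1.5] -/
theorem abs_gaussF_sub_sG_le (hS : 1 ≤ S) {x : ℤ} (hx : 4 * (x : ℝ) ^ 2 ≤ U * (S : ℝ)) :
    |gaussF (Real.pi / S) x - (sG S p U x : ℝ)| ≤ 1 / (2 : ℝ) ^ p := by
  unfold sG
  split_ifs with h
  · have e : ((x.toNat : ℕ) : ℝ) = (x : ℝ) := by exact_mod_cast Int.toNat_of_nonneg h
    have := abs_gaussF_sub_gaussFApprox_le hS (u := x.toNat) (U := U) (p := p) (by rwa [e])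
    rwa [e] at this
  · push Not at h
    have e : (((-x).toNat : ℕ) : ℝ) = -(x : ℝ) := by
      have := Int.toNat_of_nonneg (show 0 ≤ -x by omega); exact_mod_cast this
    have key := abs_gaussF_sub_gaussFApprox_le hS (u := (-x).toNat) (U := U) (p := p) (by rw [e]; simpa using hx)
    rw [e, gaussF_neg] at key
    rw [Rat.cast_neg, show gaussF (Real.pi / S) x - -(gaussFApprox S (-x).toNat p U : ℝ) =
      -(-gaussF (Real.pi / S) x - (gaussFApprox S (-x).toNat p U : ℝ)) by ring, abs_neg]
    exact key

/-! ### The endpoints and the table -/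

/-- The lower endpoint `h·2^{ℓ−j} − 2^{ℓ−1}`. [cite: GroverRudolph2002, eq. (3)] -/
def loZ (ℓ j h : ℕ) : ℤ := (h * 2 ^ (ℓ - j) : ℕ) - 2 ^ (ℓ - 1)

/-- The upper endpoint `h·2^{ℓ−j} + 2^{ℓ−j} − 2^{ℓ−1}`. [cite: GroverRudolph2002, eq. (3)] -/
def hiZ (ℓ j h : ℕ) : ℤ := (h * 2 ^ (ℓ - j) : ℕ) + 2 ^ (ℓ - j) - 2 ^ (ℓ - 1)

/-- The lower endpoint as a real. [folklore] -/
theorem cast_loZ (ℓ j h : ℕ) : ((loZ ℓ j h : ℤ) : ℝ) = ((h * 2 ^ (ℓ - j) : ℕ) : ℝ) - (2 : ℝ) ^ (ℓ - 1) := by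
  unfold loZ; push_cast; ring

/-- The upper endpoint as a real. [folklore] -/
theorem cast_hiZ (ℓ j h : ℕ) : ((hiZ ℓ j h : ℤ) : ℝ) = ((h * 2 ^ (ℓ - j) : ℕ) : ℝ) + (2 : ℝ) ^ (ℓ - j) - (2 : ℝ) ^ (ℓ - 1) := by
  unfold hiZ; push_cast; ring

variable (S p U)

/-- **The mass table**: `T j h = sG(hi) − sG(lo)`. [cite: Regev2009, Lemma 3.12 (proof)] -/
def tableT (ℓ j h : ℕ) : ℚ := sG S p U (hiZ ℓ j h) - sG S p U (loZ ℓ j h)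

variable {S p U}

/-- The endpoints of a prefix satisfy `4x² ≤ 4·4^ℓ`. [folklore] -/
theorem endpoints_sq_le {ℓ j h : ℕ} (hj : j ≤ ℓ) (hh : h < 2 ^ j) :
    4 * ((loZ ℓ j h : ℤ) : ℝ) ^ 2 ≤ 4 * (4 : ℝ) ^ ℓ ∧ 4 * ((hiZ ℓ j h : ℤ) : ℝ) ^ 2 ≤ 4 * (4 : ℝ) ^ ℓ := by
  have hpow : h * 2 ^ (ℓ - j) + 2 ^ (ℓ - j) ≤ 2 ^ ℓ := by
    calc h * 2 ^ (ℓ - j) + 2 ^ (ℓ - j) = (h + 1) * 2 ^ (ℓ - j) := by ring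
      _ ≤ 2 ^ j * 2 ^ (ℓ - j) := Nat.mul_le_mul_right _ hh
      _ = 2 ^ ℓ := by rw [← pow_add, Nat.add_sub_cancel' hj]
  have hpowR : (h : ℝ) * 2 ^ (ℓ - j) + 2 ^ (ℓ - j) ≤ 2 ^ ℓ := by exact_mod_cast hpow
  have h4 : (4 : ℝ) ^ ℓ = (2 ^ ℓ) ^ 2 := by rw [← pow_mul, mul_comm, pow_mul]; norm_num
  have h1 : (2 : ℝ) ^ (ℓ - 1) ≤ 2 ^ ℓ := pow_le_pow_right₀ (by norm_num) (Nat.sub_le ℓ 1)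
  have hnn : (0 : ℝ) ≤ (h : ℝ) * 2 ^ (ℓ - j) := by positivity
  have hnn' : (0 : ℝ) ≤ (2 : ℝ) ^ (ℓ - j) := by positivity
  have hnn1 : (0 : ℝ) ≤ (2 : ℝ) ^ (ℓ - 1) := by positivity
  rw [cast_loZ, cast_hiZ, h4]
  push_cast
  constructor <;> nlinarith

/-- **The mass table is `2/2^p`-accurate** (`1 ≤ S`, `4·4^ℓ ≤ U·S`). [cite: Regev2009, Lemma 3.12 (proof) with §2 p. 11] -/
theorem accurate_tableT {ℓ : ℕ} (hS : 1 ≤ S) (hU : 4 * (4 : ℝ) ^ ℓ ≤ U * (S : ℝ)) :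
    Accurate (ℓ := ℓ) (Real.pi / S) (tableT S p U ℓ) (2 / (2 : ℝ) ^ p) := by
  intro j y hj
  have hh : hiVal j y < 2 ^ j := hiVal_lt j hj y
  obtain ⟨hlo, hhi⟩ := endpoints_sq_le hj hh
  have e1 := abs_gaussF_sub_sG_le (p := p) hS (hlo.trans hU)
  have e2 := abs_gaussF_sub_sG_le (p := p) hS (hhi.trans hU)
  rw [cast_loZ] at e1
  rw [cast_hiZ] at e2
  unfold tableT prefG
  rw [Rat.cast_sub, abs_sub_comm]
  rw [show gaussF (Real.pi / S) (((hiVal j y * 2 ^ (ℓ - j) : ℕ) : ℝ) + 2 ^ (ℓ - j) - 2 ^ (ℓ - 1)) -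
      gaussF (Real.pi / S) (((hiVal j y * 2 ^ (ℓ - j) : ℕ) : ℝ) - 2 ^ (ℓ - 1)) -
      ((sG S p U (hiZ ℓ j (hiVal j y)) : ℝ) - (sG S p U (loZ ℓ j (hiVal j y)) : ℝ)) =
      (gaussF (Real.pi / S) (((hiVal j y * 2 ^ (ℓ - j) : ℕ) : ℝ) + 2 ^ (ℓ - j) - 2 ^ (ℓ - 1)) - (sG S p U (hiZ ℓ j (hiVal j y)) : ℝ)) -
      (gaussF (Real.pi / S) (((hiVal j y * 2 ^ (ℓ - j) : ℕ) : ℝ) - 2 ^ (ℓ - 1)) - (sG S p U (loZ ℓ j (hiVal j y)) : ℝ)) by ring]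
  refine (abs_sub _ _).trans ?_
  rw [show (2 : ℝ) / 2 ^ p = 1 / 2 ^ p + 1 / 2 ^ p by ring]
  exact add_le_add e2 e1

end GRMassTable

end Literature.Computability.QuantumComplexity

end
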